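/-
Origin: expansion seat `planner-pub-hodgecm-qw8b-g3-0`, handover #2 v2 2026-08-18T06:48:24Z (`HOME/pub-hodgecm-qw8b-g3/lean/Qw8b3/UnitH0Connected.lean`, md5 93008201, 124 lines);
landed by the gen-7 packager in gate run 25 as `HodgeCM/Proofs/Pohlmann/UnitH0Connected.lean` (verbatim).
-/
/-
Origin: pub-hodgecm-qw8b-g3 (QW8 seat 2, gen 3; planner-pub-hodgecm-qw8b-g3-0), 2026-08-18.
Intended target `HodgeCM/Proofs/Pohlmann/UnitH0Connected.lean`, module `HodgeCM.Proofs.Pohlmann.UnitH0Connected`.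
ADDITIVE leaf over `HodgeCM.StubTree.Qw8GysinDescentH0` (qw8-g4 HANDOVER #3a, RUN 25 — imported BY ITS TREE NAME
below, so this file installs VERBATIM with NO import rewrite; it was built by this seat with that one import line pointed at a
local copy `Qw8b3chk.GysinDescentH0` of qw8-g4's 4eadf18e) and `HodgeCM.Proofs.Pohlmann.DegreeZeroGeneric` (pohl-g6, run 24).
No new inputs and no new axioms.
-/
import Summits.HodgeConjecture.HodgeCM.StubTree.Qw8GysinDescentH0
import Summits.HodgeConjecture.HodgeCM.Proofs.Pohlmann.DegreeZeroGeneric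

/-!
# CM products are connected from F-H0: the degree-`0` input of Pohlmann's theorem over the RUN-25 list

qw8-g4's F-H0 `Universe.Fact_unitH0` (unit classes `1_X ∈ H⁰(X, ℚ)`, natural, `1_X ∪ z = z`, and
`H⁰(A′, ℚ) = ℚ · 1` for the CM products `A′`; `StubTree/Qw8GysinDescentH0.lean`, run 25) was introduced to make
clause (a) of F7d a theorem.  This file records that the SAME fact discharges the one remaining degree-`0` input of
the Pohlmann side (pohl-g5/g6: `CMProdConnected`, i.e. `dim_ℚ H⁰(A′, ℚ) = 1`, equivalently `CMProdH0Nontrivial`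
over the generic cone — `Proofs/Pohlmann/DegreeZeroGeneric.lean`, and `DegreeZeroDescent.lean` of this seat):

* `unitH0_one_ne_zero` — the unit class of a CM product is nonzero: otherwise `z = 1 ∪ z = 0` for every class
  `z`, contradicting `dim_ℚ H¹(A′, ℚ) = (n+1)[F:ℚ] > 0` (M22, `finrank_coh_one_cmProd`);
* `cmProdConnected_of_unitH0 : ModelAxioms → Fact_unitH0 → CMProdConnected` (`H⁰(A′) = ℚ · 1` with `1 ≠ 0`);
* `pull_H0_cmProd_of_unitH0` — N3 `Fact_pull_H0` restricted to endomorphisms of CM products FOLLOWS from F-H0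
  (recorded, not consumed: the cone's theorems take the full N3);
* `pohlmannTheorem31All_of_unitH0 : ModelAxioms → N1 → N2 → N3 → N4 → Fact_unitH0 → PohlmannTheorem31All` —
  Gao–Ullmo Thm 3.1 "(Pohlmann)", both sentences, EVERY `p ≥ 0`, with NO degree-`0` residual;
* `Assembly.COR_CM_and_pohlmannAll_of_descentFactsB` — the [QW8]-side end state `COR_CM_of_descentFactsB`
  (qw8-g4, run 25) AND the all-degree Pohlmann theorem from ONE binder list
  `ModelAxioms, RealisationExistsFace, N1–N4, F4, F5, F-H0, F7d-B, Fact_dimProd` — every generic binder of which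
  holds in one model (`HodgeCM.Toy.descentFactsB_consistent`, qw8-g4 `Model/Toy/ToyUnitH0.lean`).
-/

noncomputable section

open scoped TensorProduct NumberField

namespace HodgeCM

namespace Universe

open Literature.AlgebraicGeometry.Motives (CMType)

variable {U : Universe}

/-- **The unit class of a CM product is nonzero**: if `1_{A′} = 0` then `z = 1 ∪ z = 0` for every `z ∈ H¹(A′, ℚ)`,
contradicting `dim_ℚ H¹(A′, ℚ) = (n+1)[F:ℚ] > 0` (M22). -/
theorem unitH0_one_ne_zero (M : U.ModelAxioms) {one : ∀ X : U.Var, U.Coh X 0}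
    (hcup : ∀ (X : U.Var) (l : ℕ) (z : U.Coh X l), U.cup X 0 l (one X) z = U.castCoh X (Nat.zero_add l).symm z)
    (F : CMField) {n : ℕ} (Θ : Fin (n + 1) → CMType F) : one (U.cmProd F Θ) ≠ 0 := by
  intro h0
  have hz : ∀ z : U.Coh (U.cmProd F Θ) 1, z = 0 := fun z => by
    have h := hcup (U.cmProd F Θ) 1 z
    rw [h0, map_zero, LinearMap.zero_apply] at h
    exact (LinearEquiv.map_eq_zero_iff _).mp h.symm
  haveI : Subsingleton (U.Coh (U.cmProd F Θ) 1) := ⟨fun a b => by rw [hz a, hz b]⟩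
  have hrank := finrank_coh_one_cmProd M F Θ
  rw [Module.finrank_zero_of_subsingleton] at hrank
  have hF : 0 < Module.finrank ℚ F := Module.finrank_pos
  have hpos : 0 < (n + 1) * Module.finrank ℚ F := Nat.mul_pos (Nat.succ_pos n) hF
  omega

/-- **F-H0 ⇒ `CMProdConnected`** (`dim_ℚ H⁰(A′, ℚ) = 1` for every CM product), given `ModelAxioms`
(used only for `H¹(A′, ℚ) ≠ 0`). -/
theorem cmProdConnected_of_unitH0 (M : U.ModelAxioms) (hu : U.Fact_unitH0) : U.CMProdConnected := by
  intro F n Θ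
  obtain ⟨one, -, hcup, hspan⟩ := hu
  have h1 : one (U.cmProd F Θ) ≠ 0 := unitH0_one_ne_zero M hcup F Θ
  have htop : Submodule.span ℚ {one (U.cmProd F Θ)} = ⊤ := by
    rw [eq_top_iff]
    rintro e -
    obtain ⟨r, rfl⟩ := hspan F n Θ e
    exact Submodule.smul_mem _ r (Submodule.mem_span_singleton_self _)
  rw [← finrank_top ℚ (U.Coh (U.cmProd F Θ) 0), ← htop]
  exact finrank_span_singleton h1

/-- F-H0 ⇒ `CMProdH0Nontrivial` (`H⁰(A′, ℚ) ≠ 0`). -/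
theorem cmProdH0Nontrivial_of_unitH0 (M : U.ModelAxioms) (hu : U.Fact_unitH0) : U.CMProdH0Nontrivial :=
  cmProdH0Nontrivial_of_connected (cmProdConnected_of_unitH0 M hu)

/-- **N3 on CM products follows from F-H0**: every endomorphism `f` of a CM product acts as the identity on
`H⁰(A′, ℚ) = ℚ · 1` (`f^* 1 = 1`).  Recorded for the binder census; the cone's theorems consume the full N3. -/
theorem pull_H0_cmProd_of_unitH0 (hu : U.Fact_unitH0) (F : CMField) {n : ℕ} (Θ : Fin (n + 1) → CMType F)
    (f : U.Mor (U.cmProd F Θ) (U.cmProd F Θ)) : U.pull f 0 = LinearMap.id := by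
  obtain ⟨one, hpull, -, hspan⟩ := hu
  ext e
  obtain ⟨r, rfl⟩ := hspan F n Θ e
  rw [map_smul, hpull, LinearMap.id_apply]

/-- **Gao–Ullmo Thm 3.1 "(Pohlmann)", both sentences, EVERY `p ≥ 0`, from `ModelAxioms` + N1–N4 + F-H0** —
no degree-`0` residual (pohl-g5 `pohlmannTheorem31All_of_connected` with `CMProdConnected` from F-H0). -/
theorem pohlmannTheorem31All_of_unitH0 (M : U.ModelAxioms) (hN1 : U.Fact_cupExterior) (hN2 : U.Fact_cup_hodge)
    (hN3 : U.Fact_pull_H0) (hN4 : U.Fact_hodge_F0) (hu : U.Fact_unitH0) : U.PohlmannTheorem31All :=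
  pohlmannTheorem31All_of_connected M hN1 hN2 hN3 hN4 (cmProdConnected_of_unitH0 M hu)

/-- `dim_ℚ Hdg^p(A′) = #{Hodge weights of codimension p}` for EVERY `p ≥ 0` (Galois `F`), from `ModelAxioms` +
N1–N4 + F-H0. -/
theorem finrank_hodgeClassesOf_all_of_unitH0 (M : U.ModelAxioms) (hN1 : U.Fact_cupExterior)
    (hN2 : U.Fact_cup_hodge) (hN3 : U.Fact_pull_H0) (hN4 : U.Fact_hodge_F0) (hu : U.Fact_unitH0)
    {F : CMField} [IsGalois ℚ F] {n : ℕ} (Θ : Fin (n + 1) → CMType F) (p : ℕ) :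
    Module.finrank ℚ (U.hodgeClassesOf (U.cmProd F Θ) p) =
      Nat.card {S : Fin (n + 1) → Finset ((F : Type) →+* ℂ) // IsHodgeWeight Θ p S} :=
  finrank_hodgeClassesOf_all (Θ := Θ) M hN1 hN2 hN3 hN4 (cmProdConnected_of_unitH0 M hu) p

end Universe

namespace Assembly

/-- **COR-CM AND Pohlmann's theorem in all degrees from ONE binder list** — `ModelAxioms`, the face realisation
`RealisationExistsFace`, N1–N4, F4, F5, F-H0 `Fact_unitH0`, F7d-B `Fact_gysinDescentB`, `Fact_dimProd`
(qw8-g4's run-25 [QW8]-side end state `COR_CM_of_descentFactsB`, plus the Pohlmann side with its degree-`0`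
input discharged by the same F-H0).  Every generic binder holds in one model: `HodgeCM.Toy.descentFactsB_consistent`. -/
theorem COR_CM_and_pohlmannAll_of_descentFactsB (U : Universe) (M : U.ModelAxioms)
    (hR : U.RealisationExistsFace) (hN1 : U.Fact_cupExterior) (hN2 : U.Fact_cup_hodge) (hN3 : U.Fact_pull_H0)
    (hN4 : U.Fact_hodge_F0) (h4 : U.Fact_cupAlg) (h5 : U.Fact_cupAssoc) (hu : U.Fact_unitH0)
    (hb : U.Fact_gysinDescentB) (hd : U.Fact_dimProd) : U.HC_CM ∧ U.PohlmannTheorem31All :=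
  ⟨COR_CM_of_descentFactsB U M hR hN1 hN2 hN3 hN4 h4 h5 hu hb hd,
    Universe.pohlmannTheorem31All_of_unitH0 M hN1 hN2 hN3 hN4 hu⟩

end Assembly

end HodgeCM

end
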